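import Summits.FinalStateConjecture.FinalStateConjecture.Theorems.LaminatedThresholdCombLemmaMonotoneRoot

/-!
# Comb lemma, part II — the backward graph transform on a thin cylinder

Support file for crux item stmt-FinalStateConjecture-16893 (route LaminatedThreshold, crux A; repaired Stub 1
of line `heteroclinic_comb`). Setting (no differentiability here — only the CONE-TYPE ESTIMATES that part V
extracts from the `C¹` hypotheses of the comb lemma): `E` a real normed space, `T : E × ℝ → E × ℝ` with
`T 0 = 0`, and on the cylinder `Z = B × [−r, r]`, `B = ball (0 : E) ρ`,

* the `t`-axis is `T`-invariant: `(T (0, t)).1 = 0` (the normalisation missing from the refuted typing);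
* horizontal part: `‖(T (x, t)).1 − (T (y, s)).1‖ ≤ θ ‖x − y‖ + εₛ |t − s|` (`θ ≤ 1`: contraction in `x`;
  `εₛ`: the small vertical shear near the axis);
* vertical part: `|(T (x, t)).2 − (T (y, s)).2 − μ (t − s)| ≤ η (‖x − y‖ + |t − s|)` (expansion `μ` in
  `t` up to `η`).

For a "horizontal graph" `t = g x` over `B` (`β`-Lipschitz, `|g| ≤ H`) the PULLED-BACK GRAPH `𝒢 g` is
defined by solving, for each `x ∈ B`, the real equation `(T (x, t)).2 = g ((T (x, t)).1)` for
`t ∈ [−a, a]`: its left side minus right side is `(μ − η − β εₛ)`-uniformly increasing in `t` (part I), so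
the root exists, is unique, `β`-Lipschitz and `H`-bounded in `x` (the class is invariant), monotone and
`1/(μ − η − β εₛ)`-contracting in `g`, and at the axis `|𝒢 g 0| ≤ |g 0| / (μ − η − β εₛ)` with the sign
of `g 0`. Everything is packaged, with `𝒢` existentially quantified (no definitions in this file), in
`graphTransform_package` (the registered support statement).

References: Katok–Hasselblatt, *Introduction to the modern theory of dynamical systems* (CUP 1995) §6.2
(Hadamard graph transform, cone criterion); J. Palis, Topology 8 (1969) 385 (λ-lemma).
-/

-- every `Summit.FinalStateConjecture.FinalStateConjecture.…` name repeats the summit = sub-problem segment (D-0017 layout)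
set_option linter.dupNamespace false

noncomputable section

open Set Filter Metric
open scoped Topology

namespace Summit.FinalStateConjecture.FinalStateConjecture.Theorems.LaminatedThreshold.CombLemma

section Generic

/-- A map between pseudo-metric spaces with `dist (f a) (f b) ≤ L · dist a b` on `s` is continuous on
`s`. [folklore] -/
theorem continuousOn_of_dist_le {X Y : Type*} [PseudoMetricSpace X] [PseudoMetricSpace Y] {f : X → Y}
    {s : Set X} {L : ℝ} (h : ∀ a ∈ s, ∀ b ∈ s, dist (f a) (f b) ≤ L * dist a b) : ContinuousOn f s := by
  refine Metric.continuousOn_iff.2 fun b hb ε hε ↦ ⟨ε / (|L| + 1), by positivity, fun a ha hab ↦ ?_⟩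
  have hlt : |L| * (ε / (|L| + 1)) < ε := by
    rw [mul_div_assoc', div_lt_iff₀ (by positivity)]
    nlinarith [abs_nonneg L]
  calc dist (f a) (f b) ≤ L * dist a b := h a ha b hb
    _ ≤ |L| * dist a b := mul_le_mul_of_nonneg_right (le_abs_self L) dist_nonneg
    _ ≤ |L| * (ε / (|L| + 1)) := mul_le_mul_of_nonneg_left hab.le (abs_nonneg L)
    _ < ε := hlt

end Generic

section Transform

variable {E : Type*} [NormedAddCommGroup E]
variable {T : E × ℝ → E × ℝ} {θ μ η εₛ ρ r : ℝ}

/-! ### Elementary consequences of the cylinder estimates -/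

/-- **Horizontal contraction**: with the axis `T`-invariant, `‖(T (x, t)).1‖ ≤ θ ‖x‖` on the cylinder.
[folklore] -/
theorem norm_fst_apply_le
    (hax : ∀ t ∈ Icc (-r) r, (T ((0 : E), t)).1 = 0)
    (h1 : ∀ x ∈ ball (0 : E) ρ, ∀ y ∈ ball (0 : E) ρ, ∀ t ∈ Icc (-r) r, ∀ s ∈ Icc (-r) r,
      ‖(T (x, t)).1 - (T (y, s)).1‖ ≤ θ * ‖x - y‖ + εₛ * |t - s|)
    (hρ : 0 < ρ) {x : E} (hx : x ∈ ball (0 : E) ρ) {t : ℝ} (ht : t ∈ Icc (-r) r) :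
    ‖(T (x, t)).1‖ ≤ θ * ‖x‖ := by
  have h := h1 x hx 0 (mem_ball_self hρ) t ht t ht
  rw [hax t ht, sub_zero, sub_zero, sub_self, abs_zero, mul_zero, add_zero] at h
  exact h

/-- **The cylinder is mapped into itself horizontally** (`θ ≤ 1`): `(T (x, t)).1 ∈ B`. [folklore] -/
theorem fst_apply_mem_ball
    (hax : ∀ t ∈ Icc (-r) r, (T ((0 : E), t)).1 = 0)
    (h1 : ∀ x ∈ ball (0 : E) ρ, ∀ y ∈ ball (0 : E) ρ, ∀ t ∈ Icc (-r) r, ∀ s ∈ Icc (-r) r,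
      ‖(T (x, t)).1 - (T (y, s)).1‖ ≤ θ * ‖x - y‖ + εₛ * |t - s|)
    (hρ : 0 < ρ) (hθ1 : θ ≤ 1) {x : E} (hx : x ∈ ball (0 : E) ρ) {t : ℝ} (ht : t ∈ Icc (-r) r) :
    (T (x, t)).1 ∈ ball (0 : E) ρ := by
  have h := norm_fst_apply_le hax h1 hρ hx ht
  rw [mem_ball_zero_iff] at hx ⊢
  calc ‖(T (x, t)).1‖ ≤ θ * ‖x‖ := h
    _ ≤ 1 * ‖x‖ := mul_le_mul_of_nonneg_right hθ1 (norm_nonneg _)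
    _ < ρ := by rw [one_mul]; exact hx

/-- **Vertical expansion at fixed `x`**: `(μ − η)(t − s) ≤ (T (x, t)).2 − (T (x, s)).2` for `s ≤ t`.
[folklore] -/
theorem snd_apply_incr
    (h2 : ∀ x ∈ ball (0 : E) ρ, ∀ y ∈ ball (0 : E) ρ, ∀ t ∈ Icc (-r) r, ∀ s ∈ Icc (-r) r,
      |(T (x, t)).2 - (T (y, s)).2 - μ * (t - s)| ≤ η * (‖x - y‖ + |t - s|))
    {x : E} (hx : x ∈ ball (0 : E) ρ) {s t : ℝ} (hs : s ∈ Icc (-r) r) (ht : t ∈ Icc (-r) r)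
    (hst : s ≤ t) : (μ - η) * (t - s) ≤ (T (x, t)).2 - (T (x, s)).2 := by
  have h := h2 x hx x hx t ht s hs
  rw [sub_self, norm_zero, zero_add, abs_of_nonneg (sub_nonneg.2 hst)] at h
  have h' := (abs_le.1 h).1
  nlinarith

/-- **Vertical Lipschitz bound at fixed `x`**: `|(T (x, t)).2 − (T (x, s)).2| ≤ (|μ| + η)|t − s|`.
[folklore] -/
theorem abs_snd_apply_sub_le
    (h2 : ∀ x ∈ ball (0 : E) ρ, ∀ y ∈ ball (0 : E) ρ, ∀ t ∈ Icc (-r) r, ∀ s ∈ Icc (-r) r,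
      |(T (x, t)).2 - (T (y, s)).2 - μ * (t - s)| ≤ η * (‖x - y‖ + |t - s|))
    {x : E} (hx : x ∈ ball (0 : E) ρ) {s t : ℝ} (hs : s ∈ Icc (-r) r) (ht : t ∈ Icc (-r) r) :
    |(T (x, t)).2 - (T (x, s)).2| ≤ (|μ| + η) * |t - s| := by
  have h := h2 x hx x hx t ht s hs
  rw [sub_self, norm_zero, zero_add] at h
  have htri : |(T (x, t)).2 - (T (x, s)).2| ≤
      |(T (x, t)).2 - (T (x, s)).2 - μ * (t - s)| + |μ * (t - s)| := by
    have := abs_add_le ((T (x, t)).2 - (T (x, s)).2 - μ * (t - s)) (μ * (t - s))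
    rwa [sub_add_cancel] at this
  rw [abs_mul] at htri
  nlinarith [abs_nonneg (t - s)]

/-- **Height of the image versus `μ t`**: `|(T (x, t)).2 − μ t| ≤ η (‖x‖ + |t|)` (since `T 0 = 0`).
[folklore] -/
theorem abs_snd_apply_sub_mul_le (h0 : T 0 = 0)
    (h2 : ∀ x ∈ ball (0 : E) ρ, ∀ y ∈ ball (0 : E) ρ, ∀ t ∈ Icc (-r) r, ∀ s ∈ Icc (-r) r,
      |(T (x, t)).2 - (T (y, s)).2 - μ * (t - s)| ≤ η * (‖x - y‖ + |t - s|))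
    (hρ : 0 < ρ) (hr : 0 ≤ r) {x : E} (hx : x ∈ ball (0 : E) ρ) {t : ℝ} (ht : t ∈ Icc (-r) r) :
    |(T (x, t)).2 - μ * t| ≤ η * (‖x‖ + |t|) := by
  have h0r : (0 : ℝ) ∈ Icc (-r) r := ⟨by linarith, hr⟩
  have h := h2 x hx 0 (mem_ball_self hρ) t ht 0 h0r
  have h00 : ((0 : E), (0 : ℝ)) = (0 : E × ℝ) := rfl
  rw [h00, h0] at h
  simpa using h

/-! ### The defining function `t ↦ (T (x, t)).2 − g ((T (x, t)).1)` of the pulled-back graph -/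

/-- **Uniform increase of the defining function**: for a `β`-Lipschitz `g` on `B` and `x ∈ B`, the function
`t ↦ (T (x, t)).2 − g ((T (x, t)).1)` is `(μ − η − β εₛ)`-uniformly increasing on `[−a, a] ⊆ [−r, r]`.
[folklore] -/
theorem definingFn_uniformlyIncr
    (hax : ∀ t ∈ Icc (-r) r, (T ((0 : E), t)).1 = 0)
    (h1 : ∀ x ∈ ball (0 : E) ρ, ∀ y ∈ ball (0 : E) ρ, ∀ t ∈ Icc (-r) r, ∀ s ∈ Icc (-r) r,
      ‖(T (x, t)).1 - (T (y, s)).1‖ ≤ θ * ‖x - y‖ + εₛ * |t - s|)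
    (h2 : ∀ x ∈ ball (0 : E) ρ, ∀ y ∈ ball (0 : E) ρ, ∀ t ∈ Icc (-r) r, ∀ s ∈ Icc (-r) r,
      |(T (x, t)).2 - (T (y, s)).2 - μ * (t - s)| ≤ η * (‖x - y‖ + |t - s|))
    (hρ : 0 < ρ) (hθ1 : θ ≤ 1) {β : ℝ} (hβ : 0 ≤ β) {a : ℝ} (har : a ≤ r)
    {g : E → ℝ} (hg : ∀ x ∈ ball (0 : E) ρ, ∀ y ∈ ball (0 : E) ρ, |g x - g y| ≤ β * ‖x - y‖)
    {x : E} (hx : x ∈ ball (0 : E) ρ) :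
    ∀ s ∈ Icc (-a) a, ∀ t ∈ Icc (-a) a, s ≤ t →
      (μ - η - β * εₛ) * (t - s) ≤
        ((T (x, t)).2 - g ((T (x, t)).1)) - ((T (x, s)).2 - g ((T (x, s)).1)) := by
  have hsub : Icc (-a) a ⊆ Icc (-r) r := Icc_subset_Icc (by linarith) har
  have hu : ∀ s ∈ Icc (-a) a, ∀ t ∈ Icc (-a) a, s ≤ t →
      (μ - η) * (t - s) ≤ (T (x, t)).2 - (T (x, s)).2 :=
    fun s hs t ht hst ↦ snd_apply_incr h2 hx (hsub hs) (hsub ht) hst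
  have hv : ∀ s ∈ Icc (-a) a, ∀ t ∈ Icc (-a) a, s ≤ t →
      |g ((T (x, t)).1) - g ((T (x, s)).1)| ≤ β * εₛ * (t - s) := by
    intro s hs t ht hst
    have hzt := fst_apply_mem_ball hax h1 hρ hθ1 hx (hsub ht)
    have hzs := fst_apply_mem_ball hax h1 hρ hθ1 hx (hsub hs)
    have hT := h1 x hx x hx t (hsub ht) s (hsub hs)
    rw [sub_self, norm_zero, mul_zero, zero_add, abs_of_nonneg (sub_nonneg.2 hst)] at hT
    calc |g ((T (x, t)).1) - g ((T (x, s)).1)| ≤ β * ‖(T (x, t)).1 - (T (x, s)).1‖ := hg _ hzt _ hzs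
      _ ≤ β * (εₛ * (t - s)) := mul_le_mul_of_nonneg_left hT hβ
      _ = β * εₛ * (t - s) := by ring
  have h := uniformlyIncr_sub hu hv
  intro s hs t ht hst
  have h' := h s hs t ht hst
  have heq : μ - η - β * εₛ = (μ - η) - β * εₛ := by ring
  rw [heq]
  exact h'

/-- **Continuity of the defining function** on `[−a, a]`. [folklore] -/
theorem definingFn_continuousOn
    (hax : ∀ t ∈ Icc (-r) r, (T ((0 : E), t)).1 = 0)
    (h1 : ∀ x ∈ ball (0 : E) ρ, ∀ y ∈ ball (0 : E) ρ, ∀ t ∈ Icc (-r) r, ∀ s ∈ Icc (-r) r,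
      ‖(T (x, t)).1 - (T (y, s)).1‖ ≤ θ * ‖x - y‖ + εₛ * |t - s|)
    (h2 : ∀ x ∈ ball (0 : E) ρ, ∀ y ∈ ball (0 : E) ρ, ∀ t ∈ Icc (-r) r, ∀ s ∈ Icc (-r) r,
      |(T (x, t)).2 - (T (y, s)).2 - μ * (t - s)| ≤ η * (‖x - y‖ + |t - s|))
    (hρ : 0 < ρ) (hθ1 : θ ≤ 1) {β : ℝ} {a : ℝ} (har : a ≤ r)
    {g : E → ℝ} (hg : ∀ x ∈ ball (0 : E) ρ, ∀ y ∈ ball (0 : E) ρ, |g x - g y| ≤ β * ‖x - y‖)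
    {x : E} (hx : x ∈ ball (0 : E) ρ) :
    ContinuousOn (fun t ↦ (T (x, t)).2 - g ((T (x, t)).1)) (Icc (-a) a) := by
  have hsub : Icc (-a) a ⊆ Icc (-r) r := Icc_subset_Icc (by linarith) har
  have hsnd : ContinuousOn (fun t ↦ (T (x, t)).2) (Icc (-a) a) := by
    refine continuousOn_of_dist_le (L := |μ| + η) fun t ht s hs ↦ ?_
    rw [Real.dist_eq, Real.dist_eq]
    exact abs_snd_apply_sub_le h2 hx (hsub hs) (hsub ht)
  have hfst : ContinuousOn (fun t ↦ (T (x, t)).1) (Icc (-a) a) := by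
    refine continuousOn_of_dist_le (L := εₛ) fun t ht s hs ↦ ?_
    rw [dist_eq_norm, Real.dist_eq]
    have h := h1 x hx x hx t (hsub ht) s (hsub hs)
    rwa [sub_self, norm_zero, mul_zero, zero_add] at h
  have hgc : ContinuousOn g (ball (0 : E) ρ) := by
    refine continuousOn_of_dist_le (L := β) fun u hu v hv ↦ ?_
    rw [Real.dist_eq, dist_eq_norm]
    exact hg u hu v hv
  have hmaps : MapsTo (fun t ↦ (T (x, t)).1) (Icc (-a) a) (ball (0 : E) ρ) :=
    fun t ht ↦ fst_apply_mem_ball hax h1 hρ hθ1 hx (hsub ht)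
  exact hsnd.sub (hgc.comp hfst hmaps)

/-- **Dependence of the defining function on the base point**: at a common height `t`,
`|Ψ_x(t) − Ψ_y(t)| ≤ (η + β θ) ‖x − y‖`. [folklore] -/
theorem definingFn_sub_basepoint_le
    (hax : ∀ t ∈ Icc (-r) r, (T ((0 : E), t)).1 = 0)
    (h1 : ∀ x ∈ ball (0 : E) ρ, ∀ y ∈ ball (0 : E) ρ, ∀ t ∈ Icc (-r) r, ∀ s ∈ Icc (-r) r,
      ‖(T (x, t)).1 - (T (y, s)).1‖ ≤ θ * ‖x - y‖ + εₛ * |t - s|)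
    (h2 : ∀ x ∈ ball (0 : E) ρ, ∀ y ∈ ball (0 : E) ρ, ∀ t ∈ Icc (-r) r, ∀ s ∈ Icc (-r) r,
      |(T (x, t)).2 - (T (y, s)).2 - μ * (t - s)| ≤ η * (‖x - y‖ + |t - s|))
    (hρ : 0 < ρ) (hθ1 : θ ≤ 1) {β : ℝ} (hβ : 0 ≤ β)
    {g : E → ℝ} (hg : ∀ x ∈ ball (0 : E) ρ, ∀ y ∈ ball (0 : E) ρ, |g x - g y| ≤ β * ‖x - y‖)
    {x y : E} (hx : x ∈ ball (0 : E) ρ) (hy : y ∈ ball (0 : E) ρ) {t : ℝ} (ht : t ∈ Icc (-r) r) :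
    |((T (x, t)).2 - g ((T (x, t)).1)) - ((T (y, t)).2 - g ((T (y, t)).1))| ≤
      (η + β * θ) * ‖x - y‖ := by
  have hv := h2 x hx y hy t ht t ht
  rw [sub_self, mul_zero, sub_zero, abs_zero, add_zero] at hv
  have hh := h1 x hx y hy t ht t ht
  rw [sub_self, abs_zero, mul_zero, add_zero] at hh
  have hgz : |g ((T (x, t)).1) - g ((T (y, t)).1)| ≤ β * (θ * ‖x - y‖) :=
    (hg _ (fst_apply_mem_ball hax h1 hρ hθ1 hx ht) _ (fst_apply_mem_ball hax h1 hρ hθ1 hy ht)).trans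
      (mul_le_mul_of_nonneg_left hh hβ)
  have heq : ((T (x, t)).2 - g ((T (x, t)).1)) - ((T (y, t)).2 - g ((T (y, t)).1)) =
      ((T (x, t)).2 - (T (y, t)).2) - (g ((T (x, t)).1) - g ((T (y, t)).1)) := by ring
  rw [heq]
  calc |((T (x, t)).2 - (T (y, t)).2) - (g ((T (x, t)).1) - g ((T (y, t)).1))|
      ≤ |(T (x, t)).2 - (T (y, t)).2| + |g ((T (x, t)).1) - g ((T (y, t)).1)| := abs_sub _ _
    _ ≤ η * ‖x - y‖ + β * (θ * ‖x - y‖) := add_le_add hv hgz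
    _ = (η + β * θ) * ‖x - y‖ := by ring

/-- **Signs at the ends of the search interval**: if `|g| ≤ H` on `B` and `H + η ρ ≤ (μ − η) a`
(`0 < a ≤ r`), then `Ψ_x(−a) ≤ 0 ≤ Ψ_x(a)`. [folklore] -/
theorem definingFn_signs (h0 : T 0 = 0)
    (hax : ∀ t ∈ Icc (-r) r, (T ((0 : E), t)).1 = 0)
    (h1 : ∀ x ∈ ball (0 : E) ρ, ∀ y ∈ ball (0 : E) ρ, ∀ t ∈ Icc (-r) r, ∀ s ∈ Icc (-r) r,
      ‖(T (x, t)).1 - (T (y, s)).1‖ ≤ θ * ‖x - y‖ + εₛ * |t - s|)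
    (h2 : ∀ x ∈ ball (0 : E) ρ, ∀ y ∈ ball (0 : E) ρ, ∀ t ∈ Icc (-r) r, ∀ s ∈ Icc (-r) r,
      |(T (x, t)).2 - (T (y, s)).2 - μ * (t - s)| ≤ η * (‖x - y‖ + |t - s|))
    (hρ : 0 < ρ) (hθ1 : θ ≤ 1) (hη : 0 ≤ η) {a H : ℝ} (ha : 0 < a) (har : a ≤ r)
    (hsign : H + η * ρ ≤ (μ - η) * a)
    {g : E → ℝ} (hgH : ∀ x ∈ ball (0 : E) ρ, |g x| ≤ H) {x : E} (hx : x ∈ ball (0 : E) ρ) :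
    (T (x, -a)).2 - g ((T (x, -a)).1) ≤ 0 ∧ 0 ≤ (T (x, a)).2 - g ((T (x, a)).1) := by
  have hr : 0 ≤ r := ha.le.trans har
  have hxn : ‖x‖ < ρ := mem_ball_zero_iff.1 hx
  have hηx : η * ‖x‖ ≤ η * ρ := mul_le_mul_of_nonneg_left hxn.le hη
  have hma : (-a) ∈ Icc (-r) r := ⟨by linarith, by linarith⟩
  have hpa : a ∈ Icc (-r) r := ⟨by linarith, har⟩
  have hlow := abs_snd_apply_sub_mul_le h0 h2 hρ hr hx hma
  have hup := abs_snd_apply_sub_mul_le h0 h2 hρ hr hx hpa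
  rw [abs_of_neg (by linarith : -a < 0)] at hlow
  rw [abs_of_pos ha] at hup
  have hg1 := hgH _ (fst_apply_mem_ball hax h1 hρ hθ1 hx hma)
  have hg2 := hgH _ (fst_apply_mem_ball hax h1 hρ hθ1 hx hpa)
  have hl := (abs_le.1 hlow).2
  have hu := (abs_le.1 hup).1
  have hg1' := (abs_le.1 hg1).1
  have hg2' := (abs_le.1 hg2).2
  constructor
  · nlinarith
  · nlinarith

/-! ### The graph transform, packaged -/

/-- **THE BACKWARD GRAPH TRANSFORM** (registered support statement `graphTransform_package` of crux item
stmt-FinalStateConjecture-16893; part II of the repaired comb lemma). Under the cylinder estimates and the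
numerical side conditions (`c := μ − η − β εₛ > 1` is the effective expansion; `H + η ρ ≤ (μ − η) a` makes
the search interval `[−a, a]` large enough; `η + β θ ≤ c β` and `η ρ + H ≤ c H` make the class of
`β`-Lipschitz, `H`-bounded graphs over `B` invariant), there is an operator `𝒢` on functions `E → ℝ` such
that for every `g` in the class: `𝒢 g` is in the class; for `x ∈ B`, `𝒢 g x ∈ [−a, a]` is THE solution
`t` of `(T (x, t)).2 = g ((T (x, t)).1)` in `[−a, a]` (so `T` maps the graph of `𝒢 g` into the graph of
`g`, horizontally inside `B`); at the axis `c |𝒢 g 0| ≤ |g 0|` with the sign of `g 0` preserved; and `𝒢` is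
monotone, strictly monotone and `1/c`-contracting in `g` (sup norm over `B`). [folklore] -/
theorem graphTransform_package : ∀ (E : Type) [NormedAddCommGroup E] [NormedSpace ℝ E] (T : E × ℝ → E × ℝ) (θ μ η εₛ ρ r a β H : ℝ), T 0 = 0 → 0 < ρ → 0 < a → a ≤ r → 0 ≤ θ → θ ≤ 1 → 0 ≤ η → 0 ≤ εₛ → 0 ≤ β → 0 ≤ H → 1 < μ - η - β * εₛ → H + η * ρ ≤ (μ - η) * a → η + β * θ ≤ (μ - η - β * εₛ) * β → η * ρ + H ≤ (μ - η - β * εₛ) * H → (∀ t ∈ Set.Icc (-r) r, (T ((0 : E), t)).1 = 0) → (∀ x ∈ Metric.ball (0 : E) ρ, ∀ y ∈ Metric.ball (0 : E) ρ, ∀ t ∈ Set.Icc (-r) r, ∀ s ∈ Set.Icc (-r) r, ‖(T (x, t)).1 - (T (y, s)).1‖ ≤ θ * ‖x - y‖ + εₛ * |t - s|) → (∀ x ∈ Metric.ball (0 : E) ρ, ∀ y ∈ Metric.ball (0 : E) ρ, ∀ t ∈ Set.Icc (-r) r, ∀ s ∈ Set.Icc (-r) r, |(T (x, t)).2 - (T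 (y, s)).2 - μ * (t - s)| ≤ η * (‖x - y‖ + |t - s|)) → ∃ 𝒢 : (E → ℝ) → (E → ℝ), ∀ g : E → ℝ, (∀ x ∈ Metric.ball (0 : E) ρ, ∀ y ∈ Metric.ball (0 : E) ρ, |g x - g y| ≤ β * ‖x - y‖) → (∀ x ∈ Metric.ball (0 : E) ρ, |g x| ≤ H) → (∀ x ∈ Metric.ball (0 : E) ρ, ∀ y ∈ Metric.ball (0 : E) ρ, |𝒢 g x - 𝒢 g y| ≤ β * ‖x - y‖) ∧ (∀ x ∈ Metric.ball (0 : E) ρ, |𝒢 g x| ≤ H) ∧ (∀ x ∈ Metric.ball (0 : E) ρ, 𝒢 g x ∈ Set.Icc (-a) a ∧ (T (x, 𝒢 g x)).1 ∈ Metric.ball (0 : E) ρ ∧ (T (x, 𝒢 g x)).2 = g ((T (x, 𝒢 g x)).1)) ∧ (∀ x ∈ Metric.ball (0 : E) ρ, ∀ t ∈ Set.Icc (-a) a, (T (x, t)).2 = g ((T (x, t)).1) → t = 𝒢 g x) ∧ (∀ x ∈ Metric.ball (0 : E) ρ, (μ - η - β * εₛ) * |𝒢 g x| ≤ η * ‖x‖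 + |g ((T (x, 0)).1)|) ∧ (μ - η - β * εₛ) * |𝒢 g 0| ≤ |g 0| ∧ (0 < g 0 → 0 < 𝒢 g 0) ∧ (g 0 < 0 → 𝒢 g 0 < 0) ∧ (g 0 = 0 → 𝒢 g 0 = 0) ∧ ∀ g' : E → ℝ, (∀ x ∈ Metric.ball (0 : E) ρ, ∀ y ∈ Metric.ball (0 : E) ρ, |g' x - g' y| ≤ β * ‖x - y‖) → (∀ x ∈ Metric.ball (0 : E) ρ, |g' x| ≤ H) → ((∀ z ∈ Metric.ball (0 : E) ρ, g z ≤ g' z) → ∀ x ∈ Metric.ball (0 : E) ρ, 𝒢 g x ≤ 𝒢 g' x) ∧ ((∀ z ∈ Metric.ball (0 : E) ρ, g z < g' z) → ∀ x ∈ Metric.ball (0 : E) ρ, 𝒢 g x < 𝒢 g' x) ∧ (∀ δ : ℝ, (∀ z ∈ Metric.ball (0 : E) ρ, |g z - g' z| ≤ δ) → ∀ x ∈ Metric.ball (0 : E) ρ, (μ - η - β * εₛ) * |𝒢 g x - 𝒢 g' x| ≤ δ) := by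
  intro E _ _ T θ μ η εₛ ρ r a β H h0 hρ ha har hθ0 hθ1 hη hεₛ hβ hH hc hsign hβinv hHinv hax h1 h2
  classical
  -- notation: the effective expansion and the defining function
  set c : ℝ := μ - η - β * εₛ with hc_def
  have hcpos : 0 < c := by linarith
  have haa : (-a) ≤ a := by linarith
  have h0a : (0 : ℝ) ∈ Icc (-a) a := ⟨by linarith, ha.le⟩
  have hsub : Icc (-a) a ⊆ Icc (-r) r := Icc_subset_Icc (by linarith) har
  -- the root functional
  let Ψ : (E → ℝ) → E → ℝ → ℝ := fun g x t ↦ (T (x, t)).2 - g ((T (x, t)).1)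
  -- existence of a root for graphs in the class
  have hex : ∀ g : E → ℝ, (∀ x ∈ ball (0 : E) ρ, ∀ y ∈ ball (0 : E) ρ, |g x - g y| ≤ β * ‖x - y‖) →
      (∀ x ∈ ball (0 : E) ρ, |g x| ≤ H) → ∀ x ∈ ball (0 : E) ρ, ∃ t ∈ Icc (-a) a, Ψ g x t = 0 := by
    intro g hg hgH x hx
    obtain ⟨hlo, hhi⟩ := definingFn_signs h0 hax h1 h2 hρ hθ1 hη ha har hsign hgH hx
    exact exists_root_of_continuousOn haa (definingFn_continuousOn hax h1 h2 hρ hθ1 har hg hx) hlo hhi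
  -- the transform: the root when it exists
  let 𝒢 : (E → ℝ) → (E → ℝ) := fun g x ↦
    if h : ∃ t ∈ Icc (-a) a, Ψ g x t = 0 then h.choose else 0
  have h𝒢 : ∀ g : E → ℝ, (∀ x ∈ ball (0 : E) ρ, ∀ y ∈ ball (0 : E) ρ, |g x - g y| ≤ β * ‖x - y‖) →
      (∀ x ∈ ball (0 : E) ρ, |g x| ≤ H) → ∀ x ∈ ball (0 : E) ρ, 𝒢 g x ∈ Icc (-a) a ∧ Ψ g x (𝒢 g x) = 0 := by
    intro g hg hgH x hx
    have h := hex g hg hgH x hx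
    have hdef : 𝒢 g x = h.choose := dif_pos h
    rw [hdef]
    exact h.choose_spec
  refine ⟨𝒢, fun g hg hgH ↦ ?_⟩
  have hincr : ∀ x ∈ ball (0 : E) ρ, ∀ s ∈ Icc (-a) a, ∀ t ∈ Icc (-a) a, s ≤ t →
      c * (t - s) ≤ Ψ g x t - Ψ g x s :=
    fun x hx ↦ definingFn_uniformlyIncr hax h1 h2 hρ hθ1 hβ har hg hx
  have hroot := h𝒢 g hg hgH
  -- Lipschitz bound of the new graph
  have hLip : ∀ x ∈ ball (0 : E) ρ, ∀ y ∈ ball (0 : E) ρ, |𝒢 g x - 𝒢 g y| ≤ β * ‖x - y‖ := by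
    intro x hx y hy
    obtain ⟨htx, hzx⟩ := hroot x hx
    obtain ⟨hty, hzy⟩ := hroot y hy
    have hδ : |Ψ g x (𝒢 g y) - Ψ g y (𝒢 g y)| ≤ (η + β * θ) * ‖x - y‖ :=
      definingFn_sub_basepoint_le hax h1 h2 hρ hθ1 hβ hg hx hy (hsub hty)
    have h := dist_root_root_le (hincr x hx) htx hty hzx hzy hδ
    have h' : c * |𝒢 g x - 𝒢 g y| ≤ c * (β * ‖x - y‖) :=
      h.trans ((mul_le_mul_of_nonneg_right hβinv (norm_nonneg _)).trans_eq (by ring))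
    exact le_of_mul_le_mul_left h' hcpos
  -- fine height bound of the new graph: `c |𝒢 g x| ≤ |Ψ_x(0)| ≤ η ‖x‖ + |g ((T (x, 0)).1)|`
  have hr0 : 0 ≤ r := ha.le.trans har
  have h0r : (0 : ℝ) ∈ Icc (-r) r := ⟨by linarith, hr0⟩
  have hfine : ∀ x ∈ ball (0 : E) ρ, c * |𝒢 g x| ≤ η * ‖x‖ + |g ((T (x, 0)).1)| := by
    intro x hx
    obtain ⟨htx, hzx⟩ := hroot x hx
    have h := dist_root_le (hincr x hx) htx h0a hzx
    rw [sub_zero] at h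
    have hT0 := abs_snd_apply_sub_mul_le h0 h2 hρ hr0 hx h0r
    rw [mul_zero, sub_zero, abs_zero, add_zero] at hT0
    have hΨ0 : |Ψ g x 0| ≤ η * ‖x‖ + |g ((T (x, 0)).1)| := by
      calc |Ψ g x 0| = |(T (x, 0)).2 - g ((T (x, 0)).1)| := rfl
        _ ≤ |(T (x, 0)).2| + |g ((T (x, 0)).1)| := abs_sub _ _
        _ ≤ η * ‖x‖ + |g ((T (x, 0)).1)| := add_le_add hT0 le_rfl
    exact h.trans hΨ0
  -- height bound of the new graph (class invariance)
  have hBd : ∀ x ∈ ball (0 : E) ρ, |𝒢 g x| ≤ H := by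
    intro x hx
    have h := hfine x hx
    have hgz := hgH _ (fst_apply_mem_ball hax h1 hρ hθ1 hx h0r)
    have hxn : ‖x‖ < ρ := mem_ball_zero_iff.1 hx
    have hηx : η * ‖x‖ ≤ η * ρ := mul_le_mul_of_nonneg_left hxn.le hη
    have h' : c * |𝒢 g x| ≤ c * H := by linarith
    exact le_of_mul_le_mul_left h' hcpos
  -- the axis: `Ψ g 0 t = (T (0, t)).2 - g 0`
  have h0ball : (0 : E) ∈ ball (0 : E) ρ := mem_ball_self hρ
  obtain ⟨ht0, hz0⟩ := hroot 0 h0ball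
  have hΨ00 : Ψ g 0 0 = -g 0 := by
    have h00 : ((0 : E), (0 : ℝ)) = (0 : E × ℝ) := rfl
    show (T ((0 : E), 0)).2 - g ((T ((0 : E), 0)).1) = -g 0
    rw [h00, h0]
    simp
  have haxis : c * |𝒢 g 0| ≤ |g 0| := by
    have h := dist_root_le (hincr 0 h0ball) ht0 h0a hz0
    rwa [sub_zero, hΨ00, abs_neg] at h
  have hpos : 0 < g 0 → 0 < 𝒢 g 0 := fun hg0 ↦
    lt_root_of_neg hcpos (hincr 0 h0ball) ht0 h0a hz0 (by rw [hΨ00]; linarith)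
  have hneg : g 0 < 0 → 𝒢 g 0 < 0 := fun hg0 ↦
    root_lt_of_pos hcpos (hincr 0 h0ball) ht0 h0a hz0 (by rw [hΨ00]; linarith)
  have hzero : g 0 = 0 → 𝒢 g 0 = 0 := fun hg0 ↦
    root_unique hcpos (hincr 0 h0ball) ht0 h0a hz0 (by rw [hΨ00, hg0, neg_zero])
  refine ⟨hLip, hBd, fun x hx ↦ ⟨(hroot x hx).1, fst_apply_mem_ball hax h1 hρ hθ1 hx (hsub (hroot x hx).1),
    sub_eq_zero.1 (hroot x hx).2⟩, fun x hx t ht hzero' ↦ ?_, hfine, haxis, hpos, hneg, hzero,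
    fun g' hg' hgH' ↦ ⟨fun hle x hx ↦ ?_, fun hlt x hx ↦ ?_, fun δ hδ x hx ↦ ?_⟩⟩
  · -- uniqueness of the root
    exact (root_unique hcpos (hincr x hx) (hroot x hx).1 ht (hroot x hx).2 (sub_eq_zero.2 hzero')).symm
  · -- monotonicity in `g`
    obtain ⟨htx, hzx⟩ := hroot x hx
    obtain ⟨htx', hzx'⟩ := h𝒢 g' hg' hgH' x hx
    refine root_le_of_nonneg hcpos (hincr x hx) htx htx' hzx ?_
    have hz' : (T (x, 𝒢 g' x)).1 ∈ ball (0 : E) ρ := fst_apply_mem_ball hax h1 hρ hθ1 hx (hsub htx')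
    have hle' := hle _ hz'
    show 0 ≤ (T (x, 𝒢 g' x)).2 - g ((T (x, 𝒢 g' x)).1)
    have hzx'' : (T (x, 𝒢 g' x)).2 - g' ((T (x, 𝒢 g' x)).1) = 0 := hzx'
    linarith
  · -- strict monotonicity in `g`
    obtain ⟨htx, hzx⟩ := hroot x hx
    obtain ⟨htx', hzx'⟩ := h𝒢 g' hg' hgH' x hx
    refine root_lt_of_pos hcpos (hincr x hx) htx htx' hzx ?_
    have hz' : (T (x, 𝒢 g' x)).1 ∈ ball (0 : E) ρ := fst_apply_mem_ball hax h1 hρ hθ1 hx (hsub htx')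
    have hlt' := hlt _ hz'
    show 0 < (T (x, 𝒢 g' x)).2 - g ((T (x, 𝒢 g' x)).1)
    have hzx'' : (T (x, 𝒢 g' x)).2 - g' ((T (x, 𝒢 g' x)).1) = 0 := hzx'
    linarith
  · -- contraction in `g`
    obtain ⟨htx, hzx⟩ := hroot x hx
    obtain ⟨htx', hzx'⟩ := h𝒢 g' hg' hgH' x hx
    refine dist_root_root_le (hincr x hx) htx htx' hzx hzx' ?_
    have hz' : (T (x, 𝒢 g' x)).1 ∈ ball (0 : E) ρ := fst_apply_mem_ball hax h1 hρ hθ1 hx (hsub htx')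
    have h := hδ _ hz'
    show |((T (x, 𝒢 g' x)).2 - g ((T (x, 𝒢 g' x)).1)) - ((T (x, 𝒢 g' x)).2 - g' ((T (x, 𝒢 g' x)).1))| ≤ δ
    have heq : ((T (x, 𝒢 g' x)).2 - g ((T (x, 𝒢 g' x)).1)) - ((T (x, 𝒢 g' x)).2 - g' ((T (x, 𝒢 g' x)).1)) =
        -(g ((T (x, 𝒢 g' x)).1) - g' ((T (x, 𝒢 g' x)).1)) := by ring
    rw [heq, abs_neg]
    exact h

end Transform

end Summit.FinalStateConjecture.FinalStateConjecture.Theorems.LaminatedThreshold.CombLemma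

end
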